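/-
Copyright: the b2b-balaban T⁴-continuum CRUX team, row NE7b owner lineage `t4-ne7b-p1` (gen 116). Project licence.
-/
import Summits.QuantumFields.BalabanUV.T4Continuum.Spine.NE7b.OneShotChartWeightedRows
import Summits.QuantumFields.BalabanUV.T4Continuum.Spine.NE7b.OneShotChartSupGradient
import Summits.QuantumFields.BalabanUV.T4Continuum.Spine.NE7b.BlockPropagatorSupGradient

/-!
# COMBES–THOMAS ROWS FOR THE η-GRADIENTS OF THE ONE-SHOT CHART: the weighted gradient letters of the section `H`, the block propagator
# `G′`, the fibre inverse `Γ = G′ − H(Q′G′·)` and ASE's `T⁻¹(k,ψ) = Hk + Γψ` on `ℤ^d`, `d ≥ 3`, every side —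
# `e^{μρ(blk p)}|φ(p+e_μ) − φ(p)| ≤ (n+1)⁻¹·(C_H(μ)R_k + C_Γ′(μ)R_ψ)` for `φ = Hk + Γψ`, `0 ≤ μ < δ_H ∧ δ_u∕4`: (62)'s value rows with one
# factor of the mesh (row NE7b, node U5c; (62) ∕ (47) ∕ (50) BY NAME; [folklore])

Cell `pub-balaban`, sub-cell `t4`, spine estimate NE7b (`T4WeightBudget.RelWeightBound`; the cell's OWN estimate — NOT PRINTED in
[Bałaban 1983–89], NOT PROVED).  Crux-route work under `Spine/NE7b/` by the row OWNER (`t4-ne7b-p1` gen 116) under FREEZE (0)'s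
crux-prover clause (FILING-CLAIM C-ne7bp1-g116-3); NOTHING of Bałaban's is named, valued or asserted; no `T4Continuum/Support` leaf
typed; no `def`, no notation; zero `sorry`.  Imports (BY NAME): the owner's (62) `…OneShotChartWeightedRows` (`weighted_HBZd`,
`weighted_Gop`, `weighted_blockAvg`, `exp_weight_exchange`, `abs_le_exp_neg_mul`, `nonneg_of_weighted`; through it (51) `abs_Gop_le`,
`abs_blockAvg_le`, (49) `summable_Gk_mul_of_bounded`), (47) `…OneShotChartSupGradient` (`abs_kerH_diff_le_sup`, `HBZd_diff_eq`), (50)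
`…BlockPropagatorSupGradient` (`exists_sum_block_abs_Gk_diff_le` = the block letter of `∇G′`, `summable_abs_Gk_diff_row`).

WHY (located).  (62) typed the weighted (Combes–Thomas) rows of the VALUES of `H`, `G′`, `Γ`, `T⁻¹`; (75) `…SupBackgroundGradient` the
PLAIN gradient letters.  Print's region conditions are local AND involve lattice derivatives ([B5] (1.65) `|∂H_k(x,y)| ≤ O(1)e^{−δ|x−y|}`),
so the localisation road needs the gradient rows in the weighted currency too.  The gradient kernels have the values' exponential profile
times `(n+1)⁻¹` ((47) `abs_kerH_diff_le_sup`, (50) `exists_sum_block_abs_Gk_diff_le`), and (62)'s exchange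
`e^{μρ(x)}e^{−b|x−y|}e^{−μρ(y)} ≤ e^{−(b−μ)|x−y|}` does the rest.  Consumer: the owner's `…SupBackgroundGradientLocalised` (the weighted
chart-gradient letter for every bounded field and the far-support form for the interacting background).  No new analysis.

WHAT IS PROVED ([folklore]; `C_H(μ) := cHs·K_d(δ_H − μ)`, `C_G(μ) := A_G·K_d(δ_u∕4 − μ)` written out; `A′` = a block-letter constant of
`∇G′` at this side ((50) supplies one for every side); `C_Γ′(μ) := A′K_d(δ_u∕4 − μ) + C_H(μ)C_G(μ)`; weights with `ρ x − ρ y ≤ |x − y|_∞`):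
* §1 `weight_rearrange`, `exp_mul_cancel` (bookkeeping); **`weighted_HBZd_diff`** (`0 ≤ μ < δ_H`, bounded `k`, `e^{μρ}|k| ≤ R`):
  `e^{μρ(blk p)}|(Hk)(p+e_μ) − (Hk)(p)| ≤ (n+1)⁻¹·C_H(μ)·R`.
* §2 `abs_sum_block_Gk_diff_mul_le`, **`weighted_Gop_diff`** (`0 ≤ μ < δ_u∕4`, bounded `ψ`, `e^{μρ∘blk}|ψ| ≤ R`):
  `e^{μρ(blk p)}|(G′ψ)(p+e_μ) − (G′ψ)(p)| ≤ (n+1)⁻¹·A′K_d(δ_u∕4 − μ)·R`.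
* §3 `weighted_fibreInverse_diff_of_letters`; **`weighted_augInverse_diff`** (`d ≥ 3`, `0 ≤ μ < δ_H`, `μ < δ_u∕4`): for `φ = Hk + Γψ`,
  `e^{μρ(blk p)}|φ(p+e_μ) − φ(p)| ≤ (n+1)⁻¹·(C_H(μ)R_k + C_Γ′(μ)R_ψ)`.
* §4 toy.

HONEST (what this is NOT).  Forward differences; constants ∕ rates existential and useless by value; the free chart only (the interacting
background's localised gradient is the consumer file); scalar `ℤ^d`; nothing of the covariant `H_k`, (A3) ∕ (A1c) (NC-NE7b-α UNRULED).
BY-NAME EFFECT ON THE WALL: NONE.  NE7b NOT PRINTED ∕ NOT PROVED; spine PROVED 0∕9; rung (B)+1 on a FINITE torus — NOT infinite volume, NOT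
the mass gap, NOT Clay.  HONEST DEPENDENCY: continuum YM on T⁴ ⇐ BetaPertH ∧ nine spine estimates (0∕9 proved); BetaPertH ⇐ (D1) ∧ (D4) ∧
CAP+tail; G-an2-4 gates asym, D1 and NE2∕3∕4.
-/

set_option autoImplicit false

noncomputable section

namespace Summit.QuantumFields.BalabanUV.T4Continuum.NE7b.OneShotChartWeightedGradientRows

open Literature.MathematicalPhysics.QuantumFieldTheory.Balaban1983to89
open B4Sect5Proof (latticeConst latticeConst_nonneg)
open B6QGQLower276 (X e blk B mem_B sum_B_const)
open B6QGQDecay237 (deltaU deltaU_pos)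
open B5Hk103ScalarZd (Gk kerH summable_expX tsum_expX_le deltaH deltaH_pos tsum_blocks)
open B5Hk165L2Zd (HBZd)
open Summit.QuantumFields.BalabanUV.Beta.D1BFx.BlockColumnSupNorm (cHs cHs_nonneg)
open Summit.QuantumFields.BalabanUV.Beta.D1BFx.PointColumnSplit (cKL cG0 cSplit)
open Summit.QuantumFields.BalabanUV.Beta.D1BFx.PointColumnDecay (cFar)
open BlockPropagatorSupNorm (supConstG_nonneg summable_Gk_mul_of_bounded)
open BlockPropagatorSupGradient (summable_abs_Gk_diff_row)
open OneShotChartSupGradient (abs_kerH_diff_le_sup HBZd_diff_eq)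
open FibreInverseSupNorm (abs_Gop_le abs_blockAvg_le)
open OneShotChartWeightedRows (weighted_HBZd weighted_Gop weighted_blockAvg exp_weight_exchange abs_le_exp_neg_mul
  nonneg_of_weighted)

variable {d : ℕ}

/-! ## §1. Weight bookkeeping; the gradient of the section `H` in the weighted currency -/

/-- Bookkeeping: `(R·e^{−y})(C·e^{−D}) = C·R·e^{−x}·(e^{x}(e^{−D}e^{−y}))`. [folklore] -/
theorem weight_rearrange (R C x y D : ℝ) : (R * Real.exp (-y)) * (C * Real.exp (-D))
    = C * R * Real.exp (-x) * (Real.exp x * (Real.exp (-D) * Real.exp (-y))) := by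
  have h : Real.exp (-x) * Real.exp x = 1 := by rw [← Real.exp_add, neg_add_cancel, Real.exp_zero]
  calc _ = C * R * (Real.exp (-x) * Real.exp x) * (Real.exp (-D) * Real.exp (-y)) := by rw [h]; ring
    _ = _ := by ring

/-- Bookkeeping: `e^{x}·(c·e^{−x}·S) = c·S`. [folklore] -/
theorem exp_mul_cancel (x c S : ℝ) : Real.exp x * (c * Real.exp (-x) * S) = c * S := by
  have h : Real.exp x * Real.exp (-x) = 1 := by rw [← Real.exp_add, add_neg_cancel, Real.exp_zero]
  calc _ = (Real.exp x * Real.exp (-x)) * (c * S) := by ring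
    _ = _ := by rw [h, one_mul]


/-- **THE WEIGHTED GRADIENT LETTER OF THE SECTION** (`d ≥ 3`, `0 ≤ μ < δ_H`): for bounded coarse data `k` with `e^{μρ(y)}|k(y)| ≤ R`,
`e^{μρ(blk p)}|(Hk)(p+e_μ) − (Hk)(p)| ≤ (n+1)⁻¹·cHs·K_d(δ_H − μ)·R` — (47)'s gradient kernel through (62)'s exchange. [folklore] -/
theorem weighted_HBZd_diff (hd : 3 ≤ d) (n : ℕ) {a : ℝ} (ha : 0 < a) {μ : ℝ} (hμ0 : 0 ≤ μ) (hμ : μ < deltaH d a)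
    {ρ : X d → ℝ} (hρ : ∀ x y, ρ x - ρ y ≤ dist x y) {k : X d → ℝ} {R R' : ℝ} (hkb : ∀ y, |k y| ≤ R')
    (hk : ∀ y, Real.exp (μ * ρ y) * |k y| ≤ R) (p : X d) (ν : Fin d) :
    Real.exp (μ * ρ (blk n p)) * |HBZd n a k (p + e ν) - HBZd n a k p|
      ≤ cHs d a / ((n : ℝ) + 1) * latticeConst d (deltaH d a - μ) * R := by
  have hR : 0 ≤ R := nonneg_of_weighted (g := id) hk
  have hb : 0 < deltaH d a - μ := sub_pos.2 hμ
  have hE : 0 < Real.exp (μ * ρ (blk n p)) := Real.exp_pos _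
  have hc : 0 ≤ cHs d a / ((n : ℝ) + 1) := div_nonneg (cHs_nonneg d ha) (by positivity)
  rw [HBZd_diff_eq n ha hkb p ν]
  have hmaj : Summable fun y : X d =>
      cHs d a / ((n : ℝ) + 1) * R * Real.exp (-(μ * ρ (blk n p))) * Real.exp (-((deltaH d a - μ) * dist (blk n p) y)) :=
    (summable_expX hb (blk n p)).mul_left _
  have hpt : ∀ y : X d, ‖k y * (kerH n a (p + e ν) y - kerH n a p y)‖
      ≤ cHs d a / ((n : ℝ) + 1) * R * Real.exp (-(μ * ρ (blk n p)))
          * Real.exp (-((deltaH d a - μ) * dist (blk n p) y)) := by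
    intro y
    rw [Real.norm_eq_abs, abs_mul]
    have h1 := abs_le_exp_neg_mul y (hk y)
    have h2 := abs_kerH_diff_le_sup hd n ha p y ν
    have h3 := exp_weight_exchange (b := deltaH d a) hμ0 hρ (blk n p) y
    calc |k y| * |kerH n a (p + e ν) y - kerH n a p y|
        ≤ (R * Real.exp (-(μ * ρ y))) * (cHs d a / ((n : ℝ) + 1) * Real.exp (-(deltaH d a * dist (blk n p) y))) :=
          mul_le_mul h1 h2 (abs_nonneg _) (by positivity)
      _ = cHs d a / ((n : ℝ) + 1) * R * Real.exp (-(μ * ρ (blk n p)))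
            * (Real.exp (μ * ρ (blk n p)) * (Real.exp (-(deltaH d a * dist (blk n p) y)) * Real.exp (-(μ * ρ y)))) :=
          weight_rearrange _ _ _ _ _
      _ ≤ _ := mul_le_mul_of_nonneg_left h3 (by positivity)
  have h := tsum_of_norm_bounded hmaj.hasSum hpt
  rw [Real.norm_eq_abs, tsum_mul_left] at h
  have hK := tsum_expX_le hb (blk n p)
  calc Real.exp (μ * ρ (blk n p)) * |∑' y : X d, k y * (kerH n a (p + e ν) y - kerH n a p y)|
      ≤ Real.exp (μ * ρ (blk n p)) * (cHs d a / ((n : ℝ) + 1) * R * Real.exp (-(μ * ρ (blk n p)))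
          * ∑' y : X d, Real.exp (-((deltaH d a - μ) * dist (blk n p) y))) := mul_le_mul_of_nonneg_left h hE.le
    _ = cHs d a / ((n : ℝ) + 1) * R * ∑' y : X d, Real.exp (-((deltaH d a - μ) * dist (blk n p) y)) :=
          exp_mul_cancel _ _ _
    _ ≤ cHs d a / ((n : ℝ) + 1) * R * latticeConst d (deltaH d a - μ) := mul_le_mul_of_nonneg_left hK (by positivity)
    _ = _ := by ring

/-! ## §2. The gradient of the block propagator `G′` in the weighted currency -/

/-- One block of the weighted gradient row of `G′` (`0 ≤ μ`; the block letter of `∇G′` with constant `A′` at this side):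
`|Σ_{q∈B(y)} (G′(p+e_μ,q) − G′(p,q))ψ(q)| ≤ A′(n+1)⁻¹·R·e^{−μρ(blk p)}·e^{−(δ_u∕4 − μ)|blk p − y|}`. [folklore] -/
theorem abs_sum_block_Gk_diff_mul_le (n : ℕ) {a : ℝ} {μ : ℝ} (hμ0 : 0 ≤ μ) {A' : ℝ} (hA0 : 0 ≤ A')
    (hA' : ∀ (p y : X d) (ν : Fin d), ∑ q ∈ B n y, |Gk n a (p + e ν) q - Gk n a p q|
      ≤ A' / ((n : ℝ) + 1) * Real.exp (-(deltaU d a / 4 * dist (blk n p) y)))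
    {ρ : X d → ℝ} (hρ : ∀ x y, ρ x - ρ y ≤ dist x y) {ψ : X d → ℝ} {R : ℝ}
    (hψ : ∀ q, Real.exp (μ * ρ (blk n q)) * |ψ q| ≤ R) (p y : X d) (ν : Fin d) :
    |∑ q ∈ B n y, (Gk n a (p + e ν) q - Gk n a p q) * ψ q|
      ≤ A' / ((n : ℝ) + 1) * R * Real.exp (-(μ * ρ (blk n p))) * Real.exp (-((deltaU d a / 4 - μ) * dist (blk n p) y)) := by
  have hR : 0 ≤ R := nonneg_of_weighted hψ
  have hA : 0 ≤ A' / ((n : ℝ) + 1) := div_nonneg hA0 (by positivity)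
  have hblk : ∀ q ∈ B n y, |ψ q| ≤ R * Real.exp (-(μ * ρ y)) := fun q hq => by
    have h := abs_le_exp_neg_mul (ρ := ρ) (blk n q) (hψ q)
    rwa [mem_B.1 hq] at h
  have h3 := exp_weight_exchange (b := deltaU d a / 4) hμ0 hρ (blk n p) y
  calc |∑ q ∈ B n y, (Gk n a (p + e ν) q - Gk n a p q) * ψ q|
      ≤ ∑ q ∈ B n y, |(Gk n a (p + e ν) q - Gk n a p q) * ψ q| := Finset.abs_sum_le_sum_abs _ _
    _ ≤ ∑ q ∈ B n y, |Gk n a (p + e ν) q - Gk n a p q| * (R * Real.exp (-(μ * ρ y))) :=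
        Finset.sum_le_sum fun q hq => by
          rw [abs_mul]; exact mul_le_mul_of_nonneg_left (hblk q hq) (abs_nonneg _)
    _ = (∑ q ∈ B n y, |Gk n a (p + e ν) q - Gk n a p q|) * (R * Real.exp (-(μ * ρ y))) := by rw [Finset.sum_mul]
    _ ≤ (A' / ((n : ℝ) + 1) * Real.exp (-(deltaU d a / 4 * dist (blk n p) y))) * (R * Real.exp (-(μ * ρ y))) :=
        mul_le_mul_of_nonneg_right (hA' p y ν) (by positivity)
    _ = A' / ((n : ℝ) + 1) * R * Real.exp (-(μ * ρ (blk n p)))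
          * (Real.exp (μ * ρ (blk n p)) * (Real.exp (-(deltaU d a / 4 * dist (blk n p) y)) * Real.exp (-(μ * ρ y)))) := by
        rw [mul_comm (A' / ((n : ℝ) + 1)) (Real.exp _), ← weight_rearrange]; ring
    _ ≤ _ := mul_le_mul_of_nonneg_left h3 (by positivity)

/-- **THE WEIGHTED GRADIENT LETTER OF THE BLOCK PROPAGATOR** (`a > 0`, `0 ≤ μ < δ_u∕4`; the block letter of `∇G′` with constant `A′`
at this side): for bounded `ψ` with `e^{μρ(blk q)}|ψ(q)| ≤ R`,
`e^{μρ(blk p)}|(G′ψ)(p+e_μ) − (G′ψ)(p)| ≤ (n+1)⁻¹·A′·K_d(δ_u∕4 − μ)·R`. [folklore] -/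
theorem weighted_Gop_diff (n : ℕ) {a : ℝ} (ha : 0 < a) {μ : ℝ} (hμ0 : 0 ≤ μ) (hμ : μ < deltaU d a / 4) {A' : ℝ}
    (hA0 : 0 ≤ A')
    (hA' : ∀ (p y : X d) (ν : Fin d), ∑ q ∈ B n y, |Gk n a (p + e ν) q - Gk n a p q|
      ≤ A' / ((n : ℝ) + 1) * Real.exp (-(deltaU d a / 4 * dist (blk n p) y)))
    {ρ : X d → ℝ} (hρ : ∀ x y, ρ x - ρ y ≤ dist x y) {ψ : X d → ℝ} {R R' : ℝ} (hψb : ∀ q, |ψ q| ≤ R')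
    (hψ : ∀ q, Real.exp (μ * ρ (blk n q)) * |ψ q| ≤ R) (p : X d) (ν : Fin d) :
    Real.exp (μ * ρ (blk n p)) * |(∑' q : X d, Gk n a (p + e ν) q * ψ q) - (∑' q : X d, Gk n a p q * ψ q)|
      ≤ A' / ((n : ℝ) + 1) * latticeConst d (deltaU d a / 4 - μ) * R := by
  have hR : 0 ≤ R := nonneg_of_weighted hψ
  have hA : 0 ≤ A' / ((n : ℝ) + 1) := div_nonneg hA0 (by positivity)
  have hb : 0 < deltaU d a / 4 - μ := sub_pos.2 hμ
  have hE : 0 < Real.exp (μ * ρ (blk n p)) := Real.exp_pos _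
  have hs : Summable fun q : X d => (Gk n a (p + e ν) q - Gk n a p q) * ψ q :=
    Summable.of_norm_bounded ((summable_abs_Gk_diff_row n ha p ν).mul_right R') fun q => by
      rw [Real.norm_eq_abs, abs_mul]; exact mul_le_mul_of_nonneg_left (hψb q) (abs_nonneg _)
  rw [← (summable_Gk_mul_of_bounded n ha hψb (p + e ν)).tsum_sub (summable_Gk_mul_of_bounded n ha hψb p),
    show (fun q => Gk n a (p + e ν) q * ψ q - Gk n a p q * ψ q) = fun q => (Gk n a (p + e ν) q - Gk n a p q) * ψ q from
      funext fun q => by ring, ← tsum_blocks n hs]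
  have hmaj : Summable fun y : X d =>
      A' / ((n : ℝ) + 1) * R * Real.exp (-(μ * ρ (blk n p))) * Real.exp (-((deltaU d a / 4 - μ) * dist (blk n p) y)) :=
    (summable_expX hb (blk n p)).mul_left _
  have h := tsum_of_norm_bounded hmaj.hasSum fun y => by
    rw [Real.norm_eq_abs]; exact abs_sum_block_Gk_diff_mul_le n hμ0 hA0 hA' hρ hψ p y ν
  rw [Real.norm_eq_abs, tsum_mul_left] at h
  have hK := tsum_expX_le hb (blk n p)
  calc Real.exp (μ * ρ (blk n p)) * |∑' y : X d, ∑ q ∈ B n y, (Gk n a (p + e ν) q - Gk n a p q) * ψ q|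
      ≤ Real.exp (μ * ρ (blk n p)) * (A' / ((n : ℝ) + 1) * R * Real.exp (-(μ * ρ (blk n p)))
          * ∑' y : X d, Real.exp (-((deltaU d a / 4 - μ) * dist (blk n p) y))) := mul_le_mul_of_nonneg_left h hE.le
    _ = A' / ((n : ℝ) + 1) * R * ∑' y : X d, Real.exp (-((deltaU d a / 4 - μ) * dist (blk n p) y)) :=
        exp_mul_cancel _ _ _
    _ ≤ A' / ((n : ℝ) + 1) * R * latticeConst d (deltaU d a / 4 - μ) := mul_le_mul_of_nonneg_left hK (by positivity)
    _ = _ := by ring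

/-! ## §3. The gradient of the fibre inverse `Γ` and of `T⁻¹(k, ψ) = Hk + Γψ` in the weighted currency -/

/-- **THE WEIGHTED GRADIENT OF THE FIBRE INVERSE, from letters**: if `∇H` is `C_H′`-bounded and `H` is used only through the weighted
gradient letter, `∇(G′ψ)` has weighted size `≤ C_G′R` and `G′ψ` weighted size `≤ C_G R` (so `Q′G′ψ` too), then
`e^{μρ(blk p)}|(Γψ)(p+e_μ) − (Γψ)(p)| ≤ (C_G′ + C_H′C_G)·R`. [folklore] -/
theorem weighted_fibreInverse_diff_of_letters (n : ℕ) {a μ : ℝ} {ρ : X d → ℝ} {ψ : X d → ℝ} {R C_G C_G' C_H' : ℝ} (ν : Fin d)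
    (hHd : ∀ (k : X d → ℝ) (R₀ R₁ : ℝ), (∀ y, |k y| ≤ R₀) → (∀ y, Real.exp (μ * ρ y) * |k y| ≤ R₁) →
      ∀ p, Real.exp (μ * ρ (blk n p)) * |HBZd n a k (p + e ν) - HBZd n a k p| ≤ C_H' * R₁)
    {R₀ : ℝ} (hGb : ∀ p, |∑' q : X d, Gk n a p q * ψ q| ≤ R₀)
    (hG : ∀ p, Real.exp (μ * ρ (blk n p)) * |∑' q : X d, Gk n a p q * ψ q| ≤ C_G * R)
    (hGd : ∀ p, Real.exp (μ * ρ (blk n p))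
      * |(∑' q : X d, Gk n a (p + e ν) q * ψ q) - (∑' q : X d, Gk n a p q * ψ q)| ≤ C_G' * R) (p : X d) :
    Real.exp (μ * ρ (blk n p)) *
        |((∑' q : X d, Gk n a (p + e ν) q * ψ q)
            - HBZd n a (fun y => (((n : ℝ) + 1) ^ d)⁻¹ * ∑ p' ∈ B n y, ∑' q : X d, Gk n a p' q * ψ q) (p + e ν))
          - ((∑' q : X d, Gk n a p q * ψ q)
            - HBZd n a (fun y => (((n : ℝ) + 1) ^ d)⁻¹ * ∑ p' ∈ B n y, ∑' q : X d, Gk n a p' q * ψ q) p)|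
      ≤ (C_G' + C_H' * C_G) * R := by
  have hQ : ∀ y, Real.exp (μ * ρ y) * |(((n : ℝ) + 1) ^ d)⁻¹ * ∑ p' ∈ B n y, ∑' q : X d, Gk n a p' q * ψ q| ≤ C_G * R :=
    weighted_blockAvg n hG
  have hQb : ∀ y, |(((n : ℝ) + 1) ^ d)⁻¹ * ∑ p' ∈ B n y, ∑' q : X d, Gk n a p' q * ψ q| ≤ R₀ := abs_blockAvg_le n hGb
  have h2 := hHd _ _ _ hQb hQ p
  have h1 := hGd p
  have hE : 0 ≤ Real.exp (μ * ρ (blk n p)) := (Real.exp_pos _).le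
  rw [sub_sub_sub_comm]
  calc _ ≤ Real.exp (μ * ρ (blk n p)) * (|(∑' q : X d, Gk n a (p + e ν) q * ψ q) - (∑' q : X d, Gk n a p q * ψ q)|
          + |HBZd n a (fun y => (((n : ℝ) + 1) ^ d)⁻¹ * ∑ p' ∈ B n y, ∑' q : X d, Gk n a p' q * ψ q) (p + e ν)
            - HBZd n a (fun y => (((n : ℝ) + 1) ^ d)⁻¹ * ∑ p' ∈ B n y, ∑' q : X d, Gk n a p' q * ψ q) p|) :=
        mul_le_mul_of_nonneg_left (abs_sub _ _) hE
    _ ≤ C_G' * R + C_H' * (C_G * R) := by rw [mul_add]; exact add_le_add h1 h2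
    _ = (C_G' + C_H' * C_G) * R := by ring

/-- **THE WEIGHTED GRADIENT LETTER OF THE AUGMENTED INVERSE** (`d ≥ 3`, `0 ≤ μ < δ_H`, `μ < δ_u∕4`, the block letter of `∇G′` with
constant `A′` at this side): for bounded `k`, `ψ` with `e^{μρ}|k| ≤ R_k`, `e^{μρ∘blk}|ψ| ≤ R_ψ`, ASE's `φ = Hk + Γψ` obeys
`e^{μρ(blk p)}|φ(p+e_μ) − φ(p)| ≤ (n+1)⁻¹·(C_H(μ)R_k + (A′K_d(δ_u∕4 − μ) + C_H(μ)C_G(μ))R_ψ)`. [folklore] -/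
theorem weighted_augInverse_diff (hd : 3 ≤ d) (n : ℕ) {a : ℝ} (ha : 0 < a) {μ : ℝ} (hμ0 : 0 ≤ μ) (hμH : μ < deltaH d a)
    (hμU : μ < deltaU d a / 4) {A' : ℝ} (hA0 : 0 ≤ A')
    (hA' : ∀ (p y : X d) (ν : Fin d), ∑ q ∈ B n y, |Gk n a (p + e ν) q - Gk n a p q|
      ≤ A' / ((n : ℝ) + 1) * Real.exp (-(deltaU d a / 4 * dist (blk n p) y)))
    {ρ : X d → ℝ} (hρ : ∀ x y, ρ x - ρ y ≤ dist x y) {k ψ : X d → ℝ} {Rk Rψ Rk' Rψ' : ℝ}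
    (hkb : ∀ y, |k y| ≤ Rk') (hk : ∀ y, Real.exp (μ * ρ y) * |k y| ≤ Rk) (hψb : ∀ q, |ψ q| ≤ Rψ')
    (hψ : ∀ q, Real.exp (μ * ρ (blk n q)) * |ψ q| ≤ Rψ) (p : X d) (ν : Fin d) :
    Real.exp (μ * ρ (blk n p)) *
        |(HBZd n a k (p + e ν) + ((∑' q : X d, Gk n a (p + e ν) q * ψ q)
            - HBZd n a (fun y => (((n : ℝ) + 1) ^ d)⁻¹ * ∑ p' ∈ B n y, ∑' q : X d, Gk n a p' q * ψ q) (p + e ν)))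
          - (HBZd n a k p + ((∑' q : X d, Gk n a p q * ψ q)
            - HBZd n a (fun y => (((n : ℝ) + 1) ^ d)⁻¹ * ∑ p' ∈ B n y, ∑' q : X d, Gk n a p' q * ψ q) p))|
      ≤ ((n : ℝ) + 1)⁻¹ * (cHs d a * latticeConst d (deltaH d a - μ) * Rk
          + (A' * latticeConst d (deltaU d a / 4 - μ) + cHs d a * latticeConst d (deltaH d a - μ)
              * (((cG0 d * cKL d (d - 2) + cSplit d a) * Real.exp (2 * deltaU d a)
                  + cFar d a * Real.exp (4 * deltaU d a) / deltaU d a ^ 2) * latticeConst d (deltaU d a / 4 - μ))) * Rψ) := by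
  have h1 := weighted_HBZd_diff hd n ha hμ0 hμH hρ hkb hk p ν
  have h2 := weighted_fibreInverse_diff_of_letters n (C_H' := cHs d a / ((n : ℝ) + 1) * latticeConst d (deltaH d a - μ))
    (C_G := ((cG0 d * cKL d (d - 2) + cSplit d a) * Real.exp (2 * deltaU d a)
      + cFar d a * Real.exp (4 * deltaU d a) / deltaU d a ^ 2) * latticeConst d (deltaU d a / 4 - μ))
    (C_G' := A' / ((n : ℝ) + 1) * latticeConst d (deltaU d a / 4 - μ)) ν
    (fun k' R₀ R₁ hk'b hk' q => weighted_HBZd_diff hd n ha hμ0 hμH hρ hk'b hk' q ν)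
    (fun q => abs_Gop_le hd n ha hψb q) (fun q => weighted_Gop hd n ha hμ0 hμU hρ hψb hψ q)
    (fun q => weighted_Gop_diff n ha hμ0 hμU hA0 hA' hρ hψb hψ q ν) p
  have hE : 0 ≤ Real.exp (μ * ρ (blk n p)) := (Real.exp_pos _).le
  rw [add_sub_add_comm]
  calc _ ≤ Real.exp (μ * ρ (blk n p)) * (|HBZd n a k (p + e ν) - HBZd n a k p|
          + |((∑' q : X d, Gk n a (p + e ν) q * ψ q)
              - HBZd n a (fun y => (((n : ℝ) + 1) ^ d)⁻¹ * ∑ p' ∈ B n y, ∑' q : X d, Gk n a p' q * ψ q) (p + e ν))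
            - ((∑' q : X d, Gk n a p q * ψ q)
              - HBZd n a (fun y => (((n : ℝ) + 1) ^ d)⁻¹ * ∑ p' ∈ B n y, ∑' q : X d, Gk n a p' q * ψ q) p)|) :=
        mul_le_mul_of_nonneg_left (abs_add_le _ _) hE
    _ ≤ cHs d a / ((n : ℝ) + 1) * latticeConst d (deltaH d a - μ) * Rk
        + (A' / ((n : ℝ) + 1) * latticeConst d (deltaU d a / 4 - μ)
            + cHs d a / ((n : ℝ) + 1) * latticeConst d (deltaH d a - μ)
              * (((cG0 d * cKL d (d - 2) + cSplit d a) * Real.exp (2 * deltaU d a)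
                  + cFar d a * Real.exp (4 * deltaU d a) / deltaU d a ^ 2) * latticeConst d (deltaU d a / 4 - μ))) * Rψ := by
        rw [mul_add]; exact add_le_add h1 h2
    _ = _ := by ring

/-! ## §4. Toy -/

/-- Toy: the bookkeeping identity on numbers — `e^{1}·(3·e^{−1}·5) = 15`. -/
example : Real.exp 1 * (3 * Real.exp (-1) * 5) = 3 * 5 := exp_mul_cancel 1 3 5

end Summit.QuantumFields.BalabanUV.T4Continuum.NE7b.OneShotChartWeightedGradientRows

end
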